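import Mathlib.Algebra.Order.Floor.Semifield
import Mathlib.Analysis.SpecialFunctions.Pow.Asymptotics
import Mathlib.Analysis.SpecialFunctions.Complex.Log
import Mathlib.FieldTheory.IntermediateField.Adjoin.Defs
import Mathlib.RingTheory.AlgebraicIndependent.Basic
import HarnessLib

/-!
# Diaz's theorem on the `d × ℓ` exponential grid (large transcendence degree) and the
# "Technical Hypothesis"

Topic `Literature/NumberTheory/Transcendental` (trunk T-TRANSCEND). Decomposition step for the
named fact `Literature.NumberTheory.Transcendental.diaz_1989` (`DiazLadder.lean`, the Gelfond ladder
`trdeg ℚ(α^β, …, α^{β^{d-1}}) ≥ [(d+1)/2]`): that statement is Corollary 2.8 of Ch. 14 of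
Nesterenko–Philippon (eds.), LNM 1752, deduced there from Diaz's main theorem (loc. cit.,
Theorem 2.7) by taking `ℓ = d`, `xᵢ = β^{i-1}`, `yⱼ = β^{j-1} log α`. Here we vendor

* `TechnicalHypothesis u` — Definition 2.6 (p. 248): a measure of linear independence of a finite
  family `u` of complex numbers ("(T.H.)"), a real definition with API
  (`TechnicalHypothesis.sum_ne_zero`, `TechnicalHypothesis.of_isEmpty`, and the workhorse
  `TechnicalHypothesis.of_lowerBound`: a lower bound `c · (∑|hᵢ|)^{-k}` implies (T.H.));
* the three conclusions of Theorem 2.7 (p. 248, "the main result of G. Diaz in [Dia2]") as the named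
  facts `Diaz1989_grid` (`t ≥ [dℓ/(ℓ+d)]`), `Diaz1989_gridX` (`t₁ ≥ [d(ℓ+1)/(ℓ+d)]`) and
  `Diaz1989_gridXY` (`t₂ ≥ dℓ/(ℓ+d)`).

Printed statements (verbatim, LNM 1752 Ch. 14, PDF p. 248).

DEFINITION 2.6. We shall say that a set `{u₁, …, u_n}` of `ℚ`-linearly independent complex numbers
satisfies the Technical Hypothesis (T.H.) if, for any `ε > 0`, there exists a positive number `H₀`
such that, for any `H ≥ H₀` and `n`-tuple `(h₁, …, h_n)` of rational integers satisfying
`0 < max{|h₁|, …, |h_n|} ≤ H`, the inequality `|h₁u₁ + ⋯ + h_nu_n| ≥ exp{-H^ε}` holds.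

THEOREM 2.7. Let `x₁, …, x_d` be complex numbers which are `ℚ`-linearly independent and satisfy
(T.H.) and `y₁, …, y_ℓ` be also complex numbers which are `ℚ`-linearly independent and satisfy
(T.H.). Let `K` a subfield of `ℂ` which contains the `dℓ` numbers `e^{xᵢyⱼ}`
(`1 ≤ i ≤ d`, `1 ≤ j ≤ ℓ`). Assume `dℓ > ℓ + d` and denote by `t` the transcendence degree over `ℚ`
of `K`. Then `t > dℓ/(ℓ+d) - 1`. Moreover the transcendence degree `t₁` of the field
`K₁ = K(x₁, …, x_d)` is bounded from below by `t₁ > (d-1)ℓ/(ℓ+d)`, and the transcendence degree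
`t₂` of the field `K₂ = K₁(y₁, …, y_ℓ)` by `t₂ ≥ dℓ/(ℓ+d)`.
REMARK. For `t ∈ ℤ` and `x ∈ ℝ`, `t > x - 1` iff `t ≥ [x]`; the conclusions for `t` and `t₁` can be
written `t ≥ [dℓ/(ℓ+d)]` and `t₁ ≥ [d(ℓ+1)/(ℓ+d)]`.

Encodings. Families are `x : Fin d → ℂ`, `y : Fin ℓ → ℂ`; `K` is an `IntermediateField ℚ ℂ`
containing all `exp (x i * y j)`; `K₁ = K(x₁,…,x_d)` is the subfield of `ℂ` generated by `K` and the
`xᵢ`, i.e. `IntermediateField.adjoin ℚ (↑K ∪ range x)`, and `K₂ = adjoin ℚ (↑K ∪ range x ∪ range y)`;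
transcendence degrees are `Algebra.trdeg ℚ ↥· : Cardinal`; `[·]` is natural-number division and
the non-strict real bound `t₂ ≥ dℓ/(ℓ+d)` is `⌈dℓ/(ℓ+d)⌉₊ ≤ t₂` (equivalent for an integer or
infinite `t₂`). In (T.H.) the bound `H` and the threshold `H₀ > 0` are real numbers,
`0 < max |hᵢ| ≤ H` is `h ≠ 0 ∧ ∀ i, |hᵢ| ≤ H`, and `H^ε` is `Real.rpow`.

Nothing is asserted about Theorem 2.7; users take `(h : Diaz1989_gridX)` etc. The proof of
Theorem 2.7 (Philippon's criterion for algebraic independence, LNM 1752 Ch. 8; Philippon's zero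
estimate on `𝔾ₘ^d`, Ch. 11; Diaz's auxiliary function with coefficients in `ℤ[e^{xᵢyⱼ}]`) is in
Diaz's paper, not reproduced in LNM 1752 (which proves only the weaker Theorem 3.1).

## References

* G. Diaz, *Grands degrés de transcendance pour des familles d'exponentielles*, J. Number Theory
  31 (1989), 1–23 (main theorem).
* Yu. V. Nesterenko, P. Philippon (eds.), *Introduction to Algebraic Independence Theory*,
  LNM 1752, Springer 2001, Ch. 14 (M. Waldschmidt), Definition 2.6, Theorem 2.7, Remark and
  Corollary 2.8, PDF pp. 248–249.
-/

noncomputable section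

open Finset Filter Topology

namespace Literature.NumberTheory.Transcendental

/-- **The Technical Hypothesis (T.H.)** for a finite family `u` of complex numbers
(Nesterenko–Philippon (eds.) 2001, Ch. 14, Definition 2.6): for every `ε > 0` there is `H₀ > 0` such
that for all real `H ≥ H₀` and all nonzero integer vectors `h` with `max |hᵢ| ≤ H`,
`|∑ hᵢ uᵢ| ≥ exp (-H^ε)`. (The source states it for `ℚ`-linearly independent `u`; the condition
itself implies that no nontrivial integer relation holds, see `TechnicalHypothesis.sum_ne_zero`.)
[cite: NesterenkoPhilippon2001, Ch. 14 Def. 2.6 p. 248] -/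
def TechnicalHypothesis {ι : Type*} [Fintype ι] (u : ι → ℂ) : Prop :=
  ∀ ε : ℝ, 0 < ε → ∃ H₀ : ℝ, 0 < H₀ ∧ ∀ H : ℝ, H₀ ≤ H → ∀ h : ι → ℤ, h ≠ 0 →
    (∀ i, (|h i| : ℝ) ≤ H) → Real.exp (-H ^ ε) ≤ ‖∑ i, (h i : ℂ) * u i‖

namespace TechnicalHypothesis

variable {ι : Type*} [Fintype ι]

/-- (T.H.) excludes every nontrivial integer relation `∑ hᵢ uᵢ = 0`. [folklore] -/
theorem sum_ne_zero {u : ι → ℂ} (hu : TechnicalHypothesis u) {h : ι → ℤ} (hh : h ≠ 0) :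
    ∑ i, (h i : ℂ) * u i ≠ 0 := by
  obtain ⟨H₀, _hH₀, hH⟩ := hu 1 one_pos
  set H : ℝ := max H₀ (∑ i, (|h i| : ℝ)) with hHdef
  have hle : ∀ i, (|h i| : ℝ) ≤ H := fun i =>
    (single_le_sum (f := fun j => (|h j| : ℝ)) (fun j _ => by positivity) (mem_univ i)).trans
      (le_max_right _ _)
  have key := hH H (le_max_left _ _) h hh hle
  intro h0
  rw [h0, norm_zero] at key
  exact (Real.exp_pos _).not_ge key

/-- An empty family satisfies (T.H.) vacuously (there is no nonzero `h`). [folklore] -/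
theorem of_isEmpty [IsEmpty ι] (u : ι → ℂ) : TechnicalHypothesis u :=
  fun _ε _hε => ⟨1, one_pos, fun _H _hH _h hh _ => (hh (Subsingleton.elim _ _)).elim⟩

/-- **A polynomial lower bound implies (T.H.).** If `c > 0` and `k` are such that
`c ≤ (∑ |hᵢ|)^k · |∑ hᵢuᵢ|` for all nonzero `h ∈ ℤ^ι`, then `u` satisfies (T.H.): indeed
`∑|hᵢ| ≤ nH` (`n = #ι`) and `c (nH)^{-k} ≥ exp(-H^ε)` for `H` large, because `log H = o(H^ε)`.
This is how (T.H.) is checked for algebraic data ("satisfied by Liouville's inequality",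
loc. cit. p. 258). [folklore] -/
theorem of_lowerBound {u : ι → ℂ} {c : ℝ} (hc : 0 < c) {k : ℕ}
    (hb : ∀ h : ι → ℤ, h ≠ 0 → c ≤ (∑ i, (|h i| : ℝ)) ^ k * ‖∑ i, (h i : ℂ) * u i‖) :
    TechnicalHypothesis u := by
  intro ε hε
  -- `n = #ι` as a real number `≥ 1` (we may use `max 1 n`).
  set n : ℝ := max 1 (Fintype.card ι) with hn
  have hn1 : 1 ≤ n := le_max_left _ _
  have hn0 : 0 < n := lt_of_lt_of_le one_pos hn1
  -- The function `H ↦ (k · log (n H) - log c) / H^ε` tends to `0` at `+∞`.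
  have hlog : Tendsto (fun H : ℝ => Real.log H / H ^ ε) atTop (𝓝 0) :=
    (isLittleO_log_rpow_atTop hε).tendsto_div_nhds_zero
  have hinv : Tendsto (fun H : ℝ => (H ^ ε)⁻¹) atTop (𝓝 0) :=
    (tendsto_rpow_atTop hε).inv_tendsto_atTop
  have hlim : Tendsto (fun H : ℝ => (k * (Real.log n + Real.log H) - Real.log c) / H ^ ε)
      atTop (𝓝 0) := by
    have e : (fun H : ℝ => (k * (Real.log n + Real.log H) - Real.log c) / H ^ ε) =
        fun H => (k * Real.log n - Real.log c) * (H ^ ε)⁻¹ + k * (Real.log H / H ^ ε) := by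
      funext H
      ring
    rw [e]
    simpa using (hinv.const_mul (k * Real.log n - Real.log c)).add (hlog.const_mul (k : ℝ))
  -- Hence eventually it is `≤ 1`; also eventually `H ≥ 1`.
  have hev : ∀ᶠ H : ℝ in atTop,
      (k * (Real.log n + Real.log H) - Real.log c) / H ^ ε ≤ 1 ∧ 1 ≤ H :=
    ((tendsto_order.1 hlim).2 1 one_pos |>.mono fun H hH => hH.le).and (eventually_ge_atTop 1)
  obtain ⟨H₁, hH₁⟩ := eventually_atTop.mp hev
  refine ⟨max 1 H₁, lt_of_lt_of_le one_pos (le_max_left _ _), fun H hH h hh hle => ?_⟩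
  have hH1 : 1 ≤ H := (le_max_left _ _).trans hH
  have hHpos : 0 < H := lt_of_lt_of_le one_pos hH1
  obtain ⟨hmain, -⟩ := hH₁ H ((le_max_right _ _).trans hH)
  have hHε : 0 < H ^ ε := Real.rpow_pos_of_pos hHpos ε
  -- `k log (nH) - log c ≤ H^ε`, i.e. `(nH)^k ≤ c · exp (H^ε)`.
  have h1 : k * (Real.log n + Real.log H) - Real.log c ≤ H ^ ε := by
    rwa [div_le_one hHε] at hmain
  have hnH : 0 < n * H := mul_pos hn0 hHpos
  have h2 : (n * H) ^ k ≤ c * Real.exp (H ^ ε) := by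
    have : Real.log ((n * H) ^ k) ≤ Real.log (c * Real.exp (H ^ ε)) := by
      rw [Real.log_pow, Real.log_mul hn0.ne' hHpos.ne', Real.log_mul hc.ne' (Real.exp_pos _).ne',
        Real.log_exp]
      linarith
    exact (Real.log_le_log_iff (pow_pos hnH k) (mul_pos hc (Real.exp_pos _))).mp this
  -- The height `S = ∑ |hᵢ|` satisfies `1 ≤ S ≤ n H`.
  set S : ℝ := ∑ i, (|h i| : ℝ) with hS
  have hS1 : 1 ≤ S := by
    obtain ⟨i, hi⟩ : ∃ i, h i ≠ 0 := Function.ne_iff.mp hh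
    have h1 : (1 : ℝ) ≤ |(h i : ℝ)| := by exact_mod_cast Int.one_le_abs hi
    have h1' : (1 : ℝ) ≤ (|h i| : ℝ) := by simpa [Int.cast_abs] using h1
    exact h1'.trans (single_le_sum (f := fun j => (|h j| : ℝ)) (fun j _ => by positivity)
      (mem_univ i))
  have hS0 : 0 < S := lt_of_lt_of_le one_pos hS1
  have hSle : S ≤ n * H := by
    calc S ≤ ∑ _i : ι, H := sum_le_sum fun i _ => hle i
      _ = Fintype.card ι * H := by rw [sum_const, card_univ, nsmul_eq_mul]
      _ ≤ n * H := mul_le_mul_of_nonneg_right (le_max_right _ _) hHpos.le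
  -- Combine: `exp(-H^ε) ≤ c / (nH)^k ≤ c / S^k ≤ |∑ hᵢuᵢ|`.
  have hb' := hb h hh
  have hSk : 0 < S ^ k := pow_pos hS0 k
  calc Real.exp (-H ^ ε) = (Real.exp (H ^ ε))⁻¹ := Real.exp_neg _
    _ ≤ c / (n * H) ^ k := by
        rw [le_div_iff₀ (pow_pos hnH k), inv_mul_le_iff₀ (Real.exp_pos _)]
        linarith [h2]
    _ ≤ c / S ^ k := by
        gcongr
    _ ≤ ‖∑ i, (h i : ℂ) * u i‖ := by
        rw [div_le_iff₀ hSk, mul_comm]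
        exact hb'

end TechnicalHypothesis

/-- **Diaz's theorem on the `d × ℓ` grid, bound for `t = trdeg K`** (Diaz 1989, main theorem;
Nesterenko–Philippon (eds.) 2001, Ch. 14, Theorem 2.7, first conclusion with the Remark): if
`x₁,…,x_d ∈ ℂ` are `ℚ`-linearly independent and satisfy (T.H.), `y₁,…,y_ℓ ∈ ℂ` likewise,
`dℓ > ℓ + d`, and `K ⊆ ℂ` is a subfield containing all `e^{xᵢyⱼ}`, then
`trdeg_ℚ K ≥ [dℓ/(ℓ+d)]` (natural-number division). Users take `(h : Diaz1989_grid)`.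
[cite: Diaz1989, main theorem (= NesterenkoPhilippon2001 Ch. 14 Thm 2.7, bound for t)]
[cite: NesterenkoPhilippon2001, Ch. 14 Thm 2.7 + Remark, p. 248] -/
def Diaz1989_grid : Prop :=
  ∀ (d ℓ : ℕ) (x : Fin d → ℂ) (y : Fin ℓ → ℂ),
    LinearIndependent ℚ x → TechnicalHypothesis x →
    LinearIndependent ℚ y → TechnicalHypothesis y → ℓ + d < d * ℓ →
    ∀ K : IntermediateField ℚ ℂ, (∀ i j, Complex.exp (x i * y j) ∈ K) →
      ((d * ℓ / (ℓ + d) : ℕ) : Cardinal) ≤ Algebra.trdeg ℚ ↥K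

/-- **Diaz's theorem on the `d × ℓ` grid, bound for `t₁ = trdeg K(x₁,…,x_d)`** (Diaz 1989, main
theorem; Nesterenko–Philippon (eds.) 2001, Ch. 14, Theorem 2.7, second conclusion with the Remark):
under the same hypotheses, `trdeg_ℚ K(x₁,…,x_d) ≥ [d(ℓ+1)/(ℓ+d)]`, i.e. `t₁ > (d-1)ℓ/(ℓ+d)`;
here `K(x₁,…,x_d)` is the subfield of `ℂ` generated by `K` and the `xᵢ`. This is the bound that
yields the Gelfond–Diaz ladder (`diaz_1989`, Cor. 2.8). Users take `(h : Diaz1989_gridX)`.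
[cite: Diaz1989, main theorem (= NesterenkoPhilippon2001 Ch. 14 Thm 2.7, bound for t₁)]
[cite: NesterenkoPhilippon2001, Ch. 14 Thm 2.7 + Remark, p. 248] -/
def Diaz1989_gridX : Prop :=
  ∀ (d ℓ : ℕ) (x : Fin d → ℂ) (y : Fin ℓ → ℂ),
    LinearIndependent ℚ x → TechnicalHypothesis x →
    LinearIndependent ℚ y → TechnicalHypothesis y → ℓ + d < d * ℓ →
    ∀ K : IntermediateField ℚ ℂ, (∀ i j, Complex.exp (x i * y j) ∈ K) →
      ((d * (ℓ + 1) / (ℓ + d) : ℕ) : Cardinal) ≤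
        Algebra.trdeg ℚ ↥(IntermediateField.adjoin ℚ ((K : Set ℂ) ∪ Set.range x))

/-- **Diaz's theorem on the `d × ℓ` grid, bound for `t₂ = trdeg K(x₁,…,x_d,y₁,…,y_ℓ)`** (Diaz 1989;
Nesterenko–Philippon (eds.) 2001, Ch. 14, Theorem 2.7, third conclusion; this non-strict bound is
already Philippon's 1986 result): under the same hypotheses, `trdeg_ℚ K(x, y) ≥ dℓ/(ℓ+d)` (real,
non-strict inequality, encoded as `⌈dℓ/(ℓ+d)⌉ ≤ t₂`). Users take `(h : Diaz1989_gridXY)`.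
[cite: Diaz1989, main theorem (= NesterenkoPhilippon2001 Ch. 14 Thm 2.7, bound for t₂)]
[cite: NesterenkoPhilippon2001, Ch. 14 Thm 2.7, p. 248] -/
def Diaz1989_gridXY : Prop :=
  ∀ (d ℓ : ℕ) (x : Fin d → ℂ) (y : Fin ℓ → ℂ),
    LinearIndependent ℚ x → TechnicalHypothesis x →
    LinearIndependent ℚ y → TechnicalHypothesis y → ℓ + d < d * ℓ →
    ∀ K : IntermediateField ℚ ℂ, (∀ i j, Complex.exp (x i * y j) ∈ K) →
      ((⌈(d * ℓ : ℚ) / (ℓ + d)⌉₊ : ℕ) : Cardinal) ≤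
        Algebra.trdeg ℚ ↥(IntermediateField.adjoin ℚ ((K : Set ℂ) ∪ Set.range x ∪ Set.range y))

/-- The three grid bounds are consistent with the printed real inequalities: for `ℓ + d > 0`,
`[dℓ/(ℓ+d)] ≤ ⌈dℓ/(ℓ+d)⌉` and `[dℓ/(ℓ+d)] ≤ [d(ℓ+1)/(ℓ+d)]` (sanity check of the encodings of
`t ≤ t₁ ≤ t₂`'s lower bounds). [folklore] -/
theorem grid_bounds_mono (d ℓ : ℕ) :
    d * ℓ / (ℓ + d) ≤ d * (ℓ + 1) / (ℓ + d) ∧ d * ℓ / (ℓ + d) ≤ ⌈(d * ℓ : ℚ) / (ℓ + d)⌉₊ := by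
  refine ⟨Nat.div_le_div_right (by nlinarith), ?_⟩
  have e : d * ℓ / (ℓ + d) = ⌊((d * ℓ : ℕ) : ℚ) / ((ℓ + d : ℕ) : ℚ)⌋₊ :=
    (Nat.floor_div_eq_div _ _).symm
  rw [e]
  push_cast
  exact Nat.floor_le_ceil _

end Literature.NumberTheory.Transcendental

end
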